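import Mathlib
import Summits.NavierStokesRegularity.NavierStokesRegularity.Statement
import Summits.NavierStokesRegularity.NavierStokesRegularity.Theses.EulerZoomLiouville
import Summits.NavierStokesRegularity.NavierStokesRegularity.Theorems.EulerZoomLiouvilleSereginZoomReduction
import Literature.Analysis.FluidPDE.ClassicalSuitable
import Literature.Analysis.FluidPDE.SuitableWeakRescaling
import Literature.Analysis.FluidPDE.NSViscosityRescaling
import Literature.Analysis.FluidPDE.ForwardDSSMollifiedSchemeEnergy
import Literature.Analysis.FluidPDE.WholeSpaceIBP
import HarnessLib

/-!
# ConservativeEngine (1/3) — the local-energy-EQUALITY toolkit (def-free)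

NODE N30 «THE VISCOUS BIRTHMARK / THE CONSERVATIVE ENGINE» of the root decomposition cell decomp-ns (lens-6 g18; critic
CLEARED 2026-08-30T16:11:31Z, decomp-ns-crit-1 g5, row 196, grade modest-plus), banked from the lens kernel
`HOME/decomp-ns-lens-6/ConservativeEngine.lean` (1196 lines, 0 sorry, std axioms) DEF-FREE (every lens predicate —
`HasLocalEnergyEqualityOn`, `IsConservative`, `InClass`, `VanishesAE`, X_Eᶜ, Zᶜ — is spelled by its body, so that the statements are
syntactically the texts of the child route's items; proofs verbatim up to renaming the dot-lemmas) under the namespace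
`Theorems.ConservativeEngine`, in three ≤ 400-line files (toolkit · Zᶜ · birthmark + deciding theorem).

THESIS.  The Euler zoom limit that the route's reduction `Z` (stmt-19834, PROVED) manufactures from a CLASSICAL Navier–Stokes
flow carries a *viscous birthmark*: it satisfies the LOCAL ENERGY **EQUALITY** (zero Duchon–Robert defect) — the approximants
are zooms of a classical flow (CKN (2.5) WITH EQUALITY), and along the vanishing-viscosity limit `2ν_k ∬ |∇u_k|² φ → 0` while
every inviscid term converges.  Hence `NavierStokesRegularity ⟸ X_Eᶜ ∧ Cov ∧ (L)` with X_Eᶜ the CONSERVATIVE half of the engine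
X_E = `EulerZoomLiouville.PowerGaugeEulerLiouville` (stmt-19832).
Sources: CKN 1982 §2 (2.5); Duchon–Robert 2000 §2/§4; Seregin arXiv:2507.08733 (p. 5) / Seregin 2026 Thm 3.1; Cheskidov–
Constantin–Friedlander–Shvydkoy 2008 Thm 1.2; tree `Theorems.EulerZoomLiouvilleSereginZoomReduction`.

This file: §2 — restriction, space–time rescaling covariance, NS zoom, Euler zoom of the local energy EQUALITY
`2ν ∬ |G|² φ = ∬ (|u|² (∂ₜφ + νΔφ) + (|u|² + 2p) u·∇φ)` (CKN (2.5) with `=`, every signed test), the vanishing-viscosity limit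
WITH EQUALITY (zero defect of the limit pair), conservativity on the slab by exhaustion, a.e. representatives.
-/

noncomputable section

set_option linter.dupNamespace false

open MeasureTheory TopologicalSpace Set Function Filter Topology Metric Module
open scoped NNReal ENNReal InnerProductSpace RealInnerProductSpace Laplacian

namespace Summit.NavierStokesRegularity.NavierStokesRegularity.Theorems.ConservativeEngine

open Literature.Analysis Literature.Analysis.FluidPDE Literature.Analysis.FunctionSpaces
open Summit.NavierStokesRegularity.NavierStokesRegularity.Theses.EulerZoomLiouville
open Summit.NavierStokesRegularity.NavierStokesRegularity.Theorems.SereginZoomReduction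

/-! ## §2 Local-energy-equality toolkit -/

section Toolkit

variable {E : Type*} [NormedAddCommGroup E] [InnerProductSpace ℝ E] [FiniteDimensional ℝ E]
  [MeasurableSpace E] [BorelSpace E]

/-- Restriction of the local energy equality to a smaller open region. [folklore] -/
theorem hasLocalEnergyEqualityOn_mono {Q Q' : Opens (ℝ × E)} {ν : ℝ} {u : ℝ → E → E} {p : ℝ → E → ℝ}
    {G : ℝ → E → E →L[ℝ] E}
    (h : (∀ φ : ℝ → E → ℝ, IsSpaceTimeTestOn Q φ →
      2 * ν * ∫ t, ∫ x, frobeniusNormSq (G t x) * φ t x =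
        ∫ t, ∫ x, (‖u t x‖ ^ 2 * (timeDeriv φ t x + ν * Δ (φ t) x) +
          (‖u t x‖ ^ 2 + 2 * p t x) * ⟪u t x, gradient (φ t) x⟫)))
    (hle : Q' ≤ Q) :
    (∀ φ : ℝ → E → ℝ, IsSpaceTimeTestOn Q' φ →
      2 * ν * ∫ t, ∫ x, frobeniusNormSq (G t x) * φ t x =
        ∫ t, ∫ x, (‖u t x‖ ^ 2 * (timeDeriv φ t x + ν * Δ (φ t) x) +
          (‖u t x‖ ^ 2 + 2 * p t x) * ⟪u t x, gradient (φ t) x⟫)) :=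
  fun φ hφ => h φ (hφ.mono hle)

/-- **Covariance of the local energy EQUALITY under space–time rescaling** `w = α u∘Φ`, `q = α² p∘Φ`,
`G ↦ (αγ) G∘Φ`, `Φ(s,y) = (t₀ + βs, x₀ + γy)`, `β = αγ`, viscosity `αν/γ` — the twin, with `=` and all
tests, of the LEI clause of the tree's `IsSuitableWeakSolutionOn.stRescale` (same chain rules, same change of
variables, factor `α³γ(βγⁿ)⁻¹` on both sides). [cite: CaffarelliKohnNirenberg1982, §2 scaling after (2.6)] -/
theorem hasLocalEnergyEqualityOn_stRescale {Q : Opens (ℝ × E)} {ν : ℝ} {u : ℝ → E → E}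
    {p : ℝ → E → ℝ} {G : ℝ → E → E →L[ℝ] E}
    (h : (∀ φ : ℝ → E → ℝ, IsSpaceTimeTestOn Q φ →
      2 * ν * ∫ t, ∫ x, frobeniusNormSq (G t x) * φ t x =
        ∫ t, ∫ x, (‖u t x‖ ^ 2 * (timeDeriv φ t x + ν * Δ (φ t) x) +
          (‖u t x‖ ^ 2 + 2 * p t x) * ⟪u t x, gradient (φ t) x⟫)))
    {α β γ : ℝ} (hα : 0 < α) (hγ : 0 < γ) (hβ : β = α * γ) (t₀ : ℝ) (x₀ : E) :
    (∀ φ : ℝ → E → ℝ, IsSpaceTimeTestOn (stPreimage β γ t₀ x₀ Q) φ →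
      2 * (α * ν / γ) * ∫ t, ∫ x, frobeniusNormSq (((α * γ) • stPull β γ t₀ x₀ G) t x) * φ t x =
        ∫ t, ∫ x, (‖(α • stPull β γ t₀ x₀ u) t x‖ ^ 2 * (timeDeriv φ t x + (α * ν / γ) * Δ (φ t) x) +
          (‖(α • stPull β γ t₀ x₀ u) t x‖ ^ 2 + 2 * (α ^ 2 • stPull β γ t₀ x₀ p) t x) * ⟪(α • stPull β γ t₀ x₀ u) t x, gradient (φ t) x⟫)) := by
  have hβ0 : 0 < β := by rw [hβ]; positivity
  intro φ hφ
  set φ' := stPull β⁻¹ γ⁻¹ (-(β⁻¹ * t₀)) (-(γ⁻¹ • x₀)) φ with hφ'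
  have hφ'Q : IsSpaceTimeTestOn Q φ' := hφ.stPull_symm hβ0.ne' hγ.ne'
  have hrepr : φ = stPull β γ t₀ x₀ φ' := (stPull_stPull_symm hβ0.ne' hγ.ne' t₀ x₀ φ).symm
  have key := h φ' hφ'Q
  -- the dissipation term
  set D : ℝ → E → ℝ := fun t x => frobeniusNormSq (G t x) * φ' t x with hD
  have keyD : ∀ s y, frobeniusNormSq (((α * γ) • stPull β γ t₀ x₀ G) s y) * φ s y =
      (α * γ) ^ 2 * D (t₀ + β * s) (x₀ + γ • y) := by
    intro s y
    have e : ((α * γ) • stPull β γ t₀ x₀ G) s y = (α * γ) • G (t₀ + β * s) (x₀ + γ • y) := rfl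
    conv_lhs => rw [hrepr]
    rw [e, frobeniusNormSq_smul, stPull_apply, hD]
    ring
  -- the right-hand side
  set R : ℝ → E → ℝ := fun t x => ‖u t x‖ ^ 2 * (timeDeriv φ' t x + ν * Δ (φ' t) x) +
      (‖u t x‖ ^ 2 + 2 * p t x) * ⟪u t x, gradient (φ' t) x⟫ with hR
  have keyR : ∀ s y,
      ‖(α • stPull β γ t₀ x₀ u) s y‖ ^ 2 * (timeDeriv φ s y + α * ν / γ * Δ (φ s) y) +
        (‖(α • stPull β γ t₀ x₀ u) s y‖ ^ 2 + 2 * (α ^ 2 • stPull β γ t₀ x₀ p) s y) *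
          ⟪(α • stPull β γ t₀ x₀ u) s y, gradient (φ s) y⟫ =
      (α ^ 3 * γ) * R (t₀ + β * s) (x₀ + γ • y) := by
    intro s y
    conv_lhs => rw [hrepr]
    rw [timeDeriv_stPull, laplacian_stPull _ _ _ _ _ _ _ (hφ'Q.contDiff_slice_two _),
      gradient_stPull, smul_stPull_apply, smul_stPull_apply, hR]
    simp only [smul_eq_mul, norm_smul, Real.norm_eq_abs, abs_of_pos hα, mul_pow,
      real_inner_smul_left, real_inner_smul_right]
    rw [hβ]
    field_simp
  simp_rw [keyD, keyR, integral_const_mul]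
  rw [integral_integral_comp_stAffine hβ0 hγ t₀ x₀ D, integral_integral_comp_stAffine hβ0 hγ t₀ x₀ R]
  simp only [smul_eq_mul]
  have e1 : 2 * (α * ν / γ) * ((α * γ) ^ 2 * ((β * γ ^ finrank ℝ E)⁻¹ * ∫ t, ∫ x, D t x)) =
      α ^ 3 * γ * (β * γ ^ finrank ℝ E)⁻¹ * (2 * ν * ∫ t, ∫ x, D t x) := by
    field_simp
  have e2 : α ^ 3 * γ * ((β * γ ^ finrank ℝ E)⁻¹ * ∫ t, ∫ x, R t x) =
      α ^ 3 * γ * (β * γ ^ finrank ℝ E)⁻¹ * ∫ t, ∫ x, R t x := by ring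
  rw [e1, e2, key]

end Toolkit

/-- **NS zoom to the unit cylinder** (`α = γ = λ`, `β = λ²`, viscosity unchanged): the local energy equality
on `Q(z₀, λ)` becomes one on `Q(0, 1)` for `(λ v∘Φ, λ² q∘Φ, λ² G∘Φ)`. [folklore] -/
theorem hasLocalEnergyEqualityOn_nsZoom {lam : ℝ} (hlam : 0 < lam) (z₀ : ℝ × (EuclideanSpace ℝ (Fin 3))) {v : ℝ → (EuclideanSpace ℝ (Fin 3)) → (EuclideanSpace ℝ (Fin 3))}
    {q : ℝ → (EuclideanSpace ℝ (Fin 3)) → ℝ} {G : ℝ → (EuclideanSpace ℝ (Fin 3)) → (EuclideanSpace ℝ (Fin 3)) →L[ℝ] (EuclideanSpace ℝ (Fin 3))}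
    (h : (∀ φ : ℝ → (EuclideanSpace ℝ (Fin 3)) → ℝ, IsSpaceTimeTestOn (parabolicCylinderOpens lam z₀) φ →
      2 * 1 * ∫ t, ∫ x, frobeniusNormSq (G t x) * φ t x =
        ∫ t, ∫ x, (‖v t x‖ ^ 2 * (timeDeriv φ t x + 1 * Δ (φ t) x) +
          (‖v t x‖ ^ 2 + 2 * q t x) * ⟪v t x, gradient (φ t) x⟫))) :
    (∀ φ : ℝ → (EuclideanSpace ℝ (Fin 3)) → ℝ, IsSpaceTimeTestOn (parabolicCylinderOpens 1 (0 : ℝ × (EuclideanSpace ℝ (Fin 3)))) φ →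
      2 * 1 * ∫ t, ∫ x, frobeniusNormSq (((lam * lam) • stPull (lam ^ 2) lam z₀.1 z₀.2 G) t x) * φ t x =
        ∫ t, ∫ x, (‖(lam • stPull (lam ^ 2) lam z₀.1 z₀.2 v) t x‖ ^ 2 * (timeDeriv φ t x + 1 * Δ (φ t) x) +
          (‖(lam • stPull (lam ^ 2) lam z₀.1 z₀.2 v) t x‖ ^ 2 + 2 * (lam ^ 2 • stPull (lam ^ 2) lam z₀.1 z₀.2 q) t x) * ⟪(lam • stPull (lam ^ 2) lam z₀.1 z₀.2 v) t x, gradient (φ t) x⟫)) := by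
  have h0 := hasLocalEnergyEqualityOn_stRescale h hlam hlam (sq lam) z₀.1 z₀.2
  have hvisc : lam * 1 / lam = 1 := by field_simp
  rw [hvisc, zoom_stPreimage_parabolicCylinderOpens hlam z₀] at h0
  exact h0

/-- **Euler zoom** (`α = λ^{1+ρ}`, `γ = λ`, `β = λ^{2+ρ}`, viscosity `1 ↦ λ^ρ`) of the local energy equality
from `Q(0,1)` to `Q(0,a)`, `λa ≤ 1` — the twin of the tree's `eulerZoom_isSuitableWeakSolutionOn`. [folklore] -/
theorem hasLocalEnergyEqualityOn_eulerZoom {ρ lam a : ℝ} (hρ : 0 ≤ ρ) (hlam : 0 < lam) (hlam1 : lam ≤ 1)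
    (ha : 0 < a) (hla : lam * a ≤ 1) {v : ℝ → (EuclideanSpace ℝ (Fin 3)) → (EuclideanSpace ℝ (Fin 3))} {q : ℝ → (EuclideanSpace ℝ (Fin 3)) → ℝ} {G : ℝ → (EuclideanSpace ℝ (Fin 3)) → (EuclideanSpace ℝ (Fin 3)) →L[ℝ] (EuclideanSpace ℝ (Fin 3))}
    (h : (∀ φ : ℝ → (EuclideanSpace ℝ (Fin 3)) → ℝ, IsSpaceTimeTestOn (parabolicCylinderOpens 1 (0 : ℝ × (EuclideanSpace ℝ (Fin 3)))) φ →
      2 * 1 * ∫ t, ∫ x, frobeniusNormSq (G t x) * φ t x =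
        ∫ t, ∫ x, (‖v t x‖ ^ 2 * (timeDeriv φ t x + 1 * Δ (φ t) x) +
          (‖v t x‖ ^ 2 + 2 * q t x) * ⟪v t x, gradient (φ t) x⟫))) :
    (∀ φ : ℝ → (EuclideanSpace ℝ (Fin 3)) → ℝ, IsSpaceTimeTestOn (parabolicCylinderOpens a (0 : ℝ × (EuclideanSpace ℝ (Fin 3)))) φ →
      2 * (lam ^ ρ) * ∫ t, ∫ x, frobeniusNormSq (((lam ^ (1 + ρ) * lam) • stPull (lam ^ (2 + ρ)) lam 0 (0 : (EuclideanSpace ℝ (Fin 3))) G) t x) * φ t x =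
        ∫ t, ∫ x, (‖((lam ^ (1 + ρ)) • stPull (lam ^ (2 + ρ)) lam 0 (0 : (EuclideanSpace ℝ (Fin 3))) v) t x‖ ^ 2 * (timeDeriv φ t x + (lam ^ ρ) * Δ (φ t) x) +
          (‖((lam ^ (1 + ρ)) • stPull (lam ^ (2 + ρ)) lam 0 (0 : (EuclideanSpace ℝ (Fin 3))) v) t x‖ ^ 2 + 2 * ((lam ^ (1 + ρ)) ^ 2 • stPull (lam ^ (2 + ρ)) lam 0 (0 : (EuclideanSpace ℝ (Fin 3))) q) t x) * ⟪((lam ^ (1 + ρ)) • stPull (lam ^ (2 + ρ)) lam 0 (0 : (EuclideanSpace ℝ (Fin 3))) v) t x, gradient (φ t) x⟫)) := by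
  have hα : 0 < lam ^ (1 + ρ) := Real.rpow_pos_of_pos hlam _
  have h0 := hasLocalEnergyEqualityOn_stRescale h hα hlam (rpow_two_add_eq hlam ρ) 0 (0 : (EuclideanSpace ℝ (Fin 3)))
  have hν : lam ^ (1 + ρ) * 1 / lam = lam ^ ρ := by
    rw [mul_one, div_eq_iff hlam.ne', Real.rpow_add hlam, Real.rpow_one, mul_comm]
  rw [hν] at h0
  exact hasLocalEnergyEqualityOn_mono h0 (parabolicCylinderOpens_le_stPreimage hρ hlam hlam1 ha hla)


section Limit

variable {E : Type*} [NormedAddCommGroup E] [InnerProductSpace ℝ E] [FiniteDimensional ℝ E]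
  [MeasurableSpace E] [BorelSpace E]

/-- **The local energy EQUALITY passes to the vanishing-viscosity limit** (the twin, with `=`, of the last
block of the tree's `isSuitableWeakSolutionOn_of_tendsto_vanishingViscosity`).  Along `v_k → u` in `L³(Q)`,
`π_k ⇀ p` in `L^{3/2}(Q)`, with `(v_k, π_k, G_k)` satisfying the local energy EQUALITY at viscosity
`ν_k → 0` and `∫_Q |G_k|² ≤ C_G` uniformly: the dissipation `2ν_k ∫ |G_k|² φ → 0` (it is `≤ 2ν_k ‖φ‖_∞ C_G`),
the viscous weight `ν_k ∫ |v_k|² Δφ → 0`, the inviscid right-hand sides converge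
(`tendsto_setIntegral_lei_rhs`) — so the limit pair has ZERO defect on `Q`:
`∬ (|u|² ∂ₜφ + (|u|² + 2p) u·∇φ) = 0` for every `φ ∈ C_c^∞(Q)`. [folklore] -/
theorem localEnergyEquality_of_tendsto_vanishingViscosity {Q : Opens (ℝ × E)}
    (hQ : volume (Q : Set (ℝ × E)) ≠ ∞) {ν : ℕ → ℝ} (hν : ∀ k, 0 ≤ ν k)
    (hνlim : Tendsto ν atTop (𝓝 0))
    {v : ℕ → ℝ → E → E} {π : ℕ → ℝ → E → ℝ} {G : ℕ → ℝ → E → E →L[ℝ] E}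
    {u : ℝ → E → E} {p : ℝ → E → ℝ} {Cp : ℝ≥0∞} (hCp : Cp ≠ ∞) {CG : ℝ≥0}
    (hπm : ∀ k, AEStronglyMeasurable (uncurry (π k)) (volume.restrict (Q : Set (ℝ × E))))
    (hG : ∀ k, HasWeakSpatialGradientOn Q (v k) (G k))
    (hlee : ∀ k, (∀ φ : ℝ → E → ℝ, IsSpaceTimeTestOn Q φ →
        2 * ν k * ∫ t, ∫ x, frobeniusNormSq ((G k) t x) * φ t x =
          ∫ t, ∫ x, (‖(v k) t x‖ ^ 2 * (timeDeriv φ t x + ν k * Δ (φ t) x) +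
            (‖(v k) t x‖ ^ 2 + 2 * (π k) t x) * ⟪(v k) t x, gradient (φ t) x⟫)))
    (hGb : ∀ k, ∫⁻ z in (Q : Set (ℝ × E)), ENNReal.ofReal (frobeniusNormSq (G k z.1 z.2)) ≤ CG)
    (hv3 : ∀ k, MemLp (uncurry (v k)) 3 (volume.restrict (Q : Set (ℝ × E))))
    (hπb : ∀ k, ∫⁻ z in (Q : Set (ℝ × E)), ‖π k z.1 z.2‖ₑ ^ (3 / 2 : ℝ) ≤ Cp)
    (hu3 : MemLp (uncurry u) 3 (volume.restrict (Q : Set (ℝ × E))))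
    (hpm : AEStronglyMeasurable (uncurry p) (volume.restrict (Q : Set (ℝ × E))))
    (hpb : ∫⁻ z in (Q : Set (ℝ × E)), ‖p z.1 z.2‖ₑ ^ (3 / 2 : ℝ) ≤ Cp)
    (hconv : Tendsto (fun k => eLpNorm (uncurry (v k) - uncurry u) 3
      (volume.restrict (Q : Set (ℝ × E)))) atTop (𝓝 0))
    (hπw : ∀ g : ℝ × E → ℝ, MemLp g 3 (volume.restrict (Q : Set (ℝ × E))) →
      Tendsto (fun k => ∫ z in (Q : Set (ℝ × E)), π k z.1 z.2 * g z) atTop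
        (𝓝 (∫ z in (Q : Set (ℝ × E)), p z.1 z.2 * g z))) :
    ∀ φ : ℝ → E → ℝ, IsSpaceTimeTestOn Q φ →
      ∫ t, ∫ x, (‖u t x‖ ^ 2 * timeDeriv φ t x + (‖u t x‖ ^ 2 + 2 * p t x) * ⟪u t x, gradient (φ t) x⟫) = 0 := by
  intro φ hφ
  set S : Set (ℝ × E) := (Q : Set (ℝ × E)) with hS
  have hSm : MeasurableSet S := Q.isOpen.measurableSet
  set μQ : Measure (ℝ × E) := volume.restrict S with hμQ
  haveI : IsFiniteMeasure μQ := ⟨by rw [hμQ, Measure.restrict_apply_univ]; exact hQ.lt_top⟩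
  have h23 : (2 : ℝ≥0∞) ≤ 3 := by norm_num
  have hv2 : ∀ k, MemLp (uncurry (v k)) 2 μQ := fun k => (hv3 k).mono_exponent h23
  have hπmem : ∀ k, MemLp (uncurry (π k)) (3 / 2) μQ ∧
      eLpNorm (uncurry (π k)) (3 / 2) μQ ≤ Cp ^ (1 / (3 / 2 : ℝ)) := fun k =>
    memLp_threeHalves_of_lintegral_le (hπm k) hCp (hπb k)
  have hpmem := memLp_threeHalves_of_lintegral_le hpm hCp hpb
  have hMt : Cp ^ (1 / (3 / 2 : ℝ)) ≠ ⊤ := ENNReal.rpow_ne_top_of_nonneg (by norm_num) hCp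
  obtain ⟨C, hC0, hφC, -, -, hΔC⟩ := hφ.exists_scalar_weights_bound
  -- ### the goal in set-integral form (with the harmless `0 * Δφ`)
  have e0 := integral_integral_lei_rhs_eq hQ 0 hu3 hpmem.1 hφ
  have e1 : ∫ t, ∫ x, (‖u t x‖ ^ 2 * timeDeriv φ t x + (‖u t x‖ ^ 2 + 2 * p t x) * ⟪u t x, gradient (φ t) x⟫) =
      ∫ t, ∫ x, (‖u t x‖ ^ 2 * (timeDeriv φ t x + 0 * Δ (φ t) x) +
        (‖u t x‖ ^ 2 + 2 * p t x) * ⟪u t x, gradient (φ t) x⟫ +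
        2 * ⟪(0 : ℝ → E → E) t x, u t x⟫ * φ t x) := by
    refine integral_congr_ae (Eventually.of_forall fun t => ?_)
    refine integral_congr_ae (Eventually.of_forall fun x => ?_)
    simp only [Pi.zero_apply, inner_zero_left, mul_zero, zero_mul, add_zero]
  rw [e1, e0]
  -- ### convergence of the inviscid right-hand sides
  have hR := tendsto_setIntegral_lei_rhs (μ := μQ) 0 hφ hMt hv3 hu3 hconv hπm
    (fun k => (hπmem k).2) hpmem.1 hπw
  -- ### the viscous weights `νₖ ∫ Δφ |vₖ|²` tend to `0`
  have hΔm : AEStronglyMeasurable (fun z : ℝ × E => Δ (φ z.1) z.2) μQ :=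
    hφ.continuous_laplacian_slice.aestronglyMeasurable
  have hV := FunctionSpaces.tendsto_integral_mul_norm_sq (μ := μQ) (fun k => (hv3 k).1)
    (hu3.mono_exponent h23) (tendsto_eLpNorm_two_of_three (fun k => (hv3 k).1.sub hu3.1) hconv) hΔm
    hC0 hΔC
  have hV0 : Tendsto (fun k => ν k * ∫ z, Δ (φ z.1) z.2 * ‖v k z.1 z.2‖ ^ 2 ∂μQ) atTop (𝓝 0) := by
    have h := hνlim.mul hV
    rw [zero_mul] at h
    exact h
  -- ### the right-hand sides at viscosity `νₖ` split as inviscid part + viscous weight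
  have hsplitR : ∀ k, ∫ z, (‖v k z.1 z.2‖ ^ 2 * (timeDeriv φ z.1 z.2 + ν k * Δ (φ z.1) z.2) +
      (‖v k z.1 z.2‖ ^ 2 + 2 * π k z.1 z.2) * ⟪v k z.1 z.2, gradient (φ z.1) z.2⟫) ∂μQ =
      (∫ z, (‖v k z.1 z.2‖ ^ 2 * (timeDeriv φ z.1 z.2 + 0 * Δ (φ z.1) z.2) +
        (‖v k z.1 z.2‖ ^ 2 + 2 * π k z.1 z.2) * ⟪v k z.1 z.2, gradient (φ z.1) z.2⟫) ∂μQ) +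
      ν k * ∫ z, Δ (φ z.1) z.2 * ‖v k z.1 z.2‖ ^ 2 ∂μQ := by
    intro k
    obtain ⟨iA, iB, iC⟩ := integrable_lei_pieces (μ := μQ) 0 hφ (hv3 k) (hπmem k).1
    have h2 : Integrable (fun z : ℝ × E => ‖v k z.1 z.2‖ ^ 2) μQ :=
      (memLp_two_iff_integrable_sq_norm (hv2 k).1).1 (hv2 k)
    have iD : Integrable (fun z : ℝ × E => Δ (φ z.1) z.2 * ‖v k z.1 z.2‖ ^ 2) μQ := by
      refine (h2.const_mul C).mono' (hΔm.mul ((hv2 k).1.norm.pow 2)) (Eventually.of_forall fun z => ?_)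
      rw [norm_mul, Real.norm_of_nonneg (by positivity : (0 : ℝ) ≤ ‖v k z.1 z.2‖ ^ 2)]
      exact mul_le_mul_of_nonneg_right (hΔC z) (by positivity)
    have i0 : Integrable (fun z : ℝ × E => ‖v k z.1 z.2‖ ^ 2 * (timeDeriv φ z.1 z.2 + 0 * Δ (φ z.1) z.2) +
        (‖v k z.1 z.2‖ ^ 2 + 2 * π k z.1 z.2) * ⟪v k z.1 z.2, gradient (φ z.1) z.2⟫) μQ := by
      have h := iA.add (iB.add (iC.const_mul 2))
      refine h.congr (Eventually.of_forall fun z => ?_)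
      simp only [Pi.add_apply]
      ring
    rw [← integral_const_mul, ← integral_add i0 (iD.const_mul _)]
    refine integral_congr_ae (Eventually.of_forall fun z => ?_)
    ring
  -- ### the local energy EQUALITIES of the `vₖ`, in set-integral form
  have hφm : AEStronglyMeasurable (uncurry φ) μQ := hφ.contDiff.continuous.aestronglyMeasurable
  have hfrob : ∀ k, Integrable (fun z : ℝ × E => frobeniusNormSq (G k z.1 z.2)) μQ ∧
      ∫ z, frobeniusNormSq (G k z.1 z.2) ∂μQ ≤ (CG : ℝ) := by
    intro k
    have hGm : AEStronglyMeasurable (uncurry (G k)) μQ := (hG k).locallyIntegrableOn_grad.aestronglyMeasurable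
    have hfm : AEStronglyMeasurable (fun z : ℝ × E => frobeniusNormSq (G k z.1 z.2)) μQ :=
      LerayHopfProofs.continuous_frobeniusNormSq.comp_aestronglyMeasurable hGm
    have hf : Integrable (fun z : ℝ × E => frobeniusNormSq (G k z.1 z.2)) μQ := by
      refine ⟨hfm, ?_⟩
      rw [hasFiniteIntegral_iff_enorm]
      refine lt_of_le_of_lt (lintegral_mono fun z => ?_) ((hGb k).trans_lt ENNReal.coe_lt_top)
      rw [Real.enorm_eq_ofReal (frobeniusNormSq_nonneg _)]
    refine ⟨hf, ?_⟩
    rw [integral_eq_lintegral_of_nonneg_ae (Eventually.of_forall fun z => frobeniusNormSq_nonneg _) hfm]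
    have h := ENNReal.toReal_mono ENNReal.coe_ne_top (hGb k)
    rwa [ENNReal.coe_toReal] at h
  have hIG : ∀ k, IntegrableOn (fun z : ℝ × E => frobeniusNormSq (G k z.1 z.2) * φ z.1 z.2) S volume := by
    intro k
    obtain ⟨hf, -⟩ := hfrob k
    refine (hf.mul_const C).mono' (hf.1.mul hφm) (Eventually.of_forall fun z => ?_)
    rw [norm_mul, Real.norm_of_nonneg (frobeniusNormSq_nonneg _)]
    exact mul_le_mul_of_nonneg_left (hφC z) (frobeniusNormSq_nonneg _)
  have hk : ∀ k, 2 * ν k * ∫ z, frobeniusNormSq (G k z.1 z.2) * φ z.1 z.2 ∂μQ =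
      ∫ z, (‖v k z.1 z.2‖ ^ 2 * (timeDeriv φ z.1 z.2 + ν k * Δ (φ z.1) z.2) +
        (‖v k z.1 z.2‖ ^ 2 + 2 * π k z.1 z.2) * ⟪v k z.1 z.2, gradient (φ z.1) z.2⟫) ∂μQ := by
    intro k
    have h := hlee k φ hφ
    have e := integral_integral_lei_rhs_eq hQ (ν k) (hv3 k) (hπmem k).1 hφ
    have e' : ∫ t, ∫ x, (‖v k t x‖ ^ 2 * (timeDeriv φ t x + ν k * Δ (φ t) x) +
        (‖v k t x‖ ^ 2 + 2 * π k t x) * ⟪v k t x, gradient (φ t) x⟫) =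
        ∫ t, ∫ x, (‖v k t x‖ ^ 2 * (timeDeriv φ t x + ν k * Δ (φ t) x) +
        (‖v k t x‖ ^ 2 + 2 * π k t x) * ⟪v k t x, gradient (φ t) x⟫ +
        2 * ⟪(0 : ℝ → E → E) t x, v k t x⟫ * φ t x) := by
      refine integral_congr_ae (Eventually.of_forall fun t => ?_)
      refine integral_congr_ae (Eventually.of_forall fun x => ?_)
      simp only [Pi.zero_apply, inner_zero_left, mul_zero, zero_mul, add_zero]
    rw [integral_integral_frobeniusNormSq_mul_eq hφ (hIG k), e', e] at h
    exact h
  -- ### the dissipation `2νₖ ∫ |Gₖ|² φ` tends to `0`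
  have hD0 : Tendsto (fun k => 2 * ν k * ∫ z, frobeniusNormSq (G k z.1 z.2) * φ z.1 z.2 ∂μQ) atTop (𝓝 0) := by
    have hbound : ∀ k, ‖2 * ν k * ∫ z, frobeniusNormSq (G k z.1 z.2) * φ z.1 z.2 ∂μQ‖ ≤
        2 * ν k * (C * CG) := by
      intro k
      obtain ⟨hf, hfle⟩ := hfrob k
      have h1 : ‖∫ z, frobeniusNormSq (G k z.1 z.2) * φ z.1 z.2 ∂μQ‖ ≤
          ∫ z, frobeniusNormSq (G k z.1 z.2) * C ∂μQ := by
        refine norm_integral_le_of_norm_le (hf.mul_const C) (Eventually.of_forall fun z => ?_)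
        rw [norm_mul, Real.norm_of_nonneg (frobeniusNormSq_nonneg _)]
        exact mul_le_mul_of_nonneg_left (hφC z) (frobeniusNormSq_nonneg _)
      rw [integral_mul_const] at h1
      rw [norm_mul, norm_mul, Real.norm_two, Real.norm_of_nonneg (hν k)]
      refine mul_le_mul_of_nonneg_left (h1.trans ?_) (mul_nonneg zero_le_two (hν k))
      rw [mul_comm]
      exact mul_le_mul_of_nonneg_left hfle hC0
    have hlim0 : Tendsto (fun k => 2 * ν k * (C * CG)) atTop (𝓝 0) := by
      have h := (hνlim.const_mul 2).mul_const (C * (CG : ℝ))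
      rw [mul_zero, zero_mul] at h
      exact h
    exact squeeze_zero_norm hbound hlim0
  -- ### the inviscid right-hand sides at level `k` are `2νₖ ∫ |Gₖ|² φ − νₖ ∫ Δφ |vₖ|²`, hence tend to `0`
  have ha : ∀ k, (∫ z, (‖v k z.1 z.2‖ ^ 2 * (timeDeriv φ z.1 z.2 + 0 * Δ (φ z.1) z.2) +
      (‖v k z.1 z.2‖ ^ 2 + 2 * π k z.1 z.2) * ⟪v k z.1 z.2, gradient (φ z.1) z.2⟫) ∂μQ) =
      2 * ν k * ∫ z, frobeniusNormSq (G k z.1 z.2) * φ z.1 z.2 ∂μQ -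
        ν k * ∫ z, Δ (φ z.1) z.2 * ‖v k z.1 z.2‖ ^ 2 ∂μQ := by
    intro k
    rw [hk k, hsplitR k]
    ring
  have hlim : Tendsto (fun k => ∫ z, (‖v k z.1 z.2‖ ^ 2 * (timeDeriv φ z.1 z.2 + 0 * Δ (φ z.1) z.2) +
      (‖v k z.1 z.2‖ ^ 2 + 2 * π k z.1 z.2) * ⟪v k z.1 z.2, gradient (φ z.1) z.2⟫) ∂μQ) atTop (𝓝 0) := by
    have h := hD0.sub hV0
    rw [sub_zero] at h
    exact h.congr fun k => (ha k).symm
  exact tendsto_nhds_unique hR hlim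

end Limit

/-- **Conservativity on the slab by exhaustion**: zero defect against every test function on every
`Q(0, 2ᵐ)` ⇒ `IsConservative` (a test function on the slab is supported in some `Q(0, 2ᵐ)`;
`ESSBlowup.exists_subset_parabolicCylinder_of_isCompact`). [folklore] -/
theorem isConservative_of_levels {u : ℝ → (EuclideanSpace ℝ (Fin 3)) → (EuclideanSpace ℝ (Fin 3))} {p : ℝ → (EuclideanSpace ℝ (Fin 3)) → ℝ}
    (h : ∀ m : ℕ, ∀ φ : ℝ → (EuclideanSpace ℝ (Fin 3)) → ℝ, IsSpaceTimeTestOn (parabolicCylinderOpens ((2 : ℝ) ^ m) (0 : ℝ × (EuclideanSpace ℝ (Fin 3)))) φ →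
      ∫ t, ∫ x, (‖u t x‖ ^ 2 * timeDeriv φ t x + (‖u t x‖ ^ 2 + 2 * p t x) * ⟪u t x, gradient (φ t) x⟫) = 0) :
    (∀ φ : ℝ → EuclideanSpace ℝ (Fin 3) → ℝ, IsSpaceTimeTestOn (slab (EuclideanSpace ℝ (Fin 3)) (Set.Iio 0) isOpen_Iio) φ →
      ∫ t, ∫ x, (‖u t x‖ ^ 2 * timeDeriv φ t x + (‖u t x‖ ^ 2 + 2 * p t x) * ⟪u t x, gradient (φ t) x⟫) = 0) := by
  intro φ hφ
  obtain ⟨n, hn⟩ := ESSBlowup.exists_subset_parabolicCylinder_of_isCompact hφ.tsupport_subset hφ.hasCompactSupport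
  have hsub : parabolicCylinder ((n : ℝ) + 1) (0 : ℝ × (EuclideanSpace ℝ (Fin 3))) ⊆ parabolicCylinder ((2 : ℝ) ^ (n + 1)) (0 : ℝ × (EuclideanSpace ℝ (Fin 3))) := by
    refine SuitableCompactness.parabolicCylinder_zero_mono (by positivity) ?_
    have h' : n + 1 ≤ 2 ^ (n + 1) := (Nat.lt_two_pow_self (n := n + 1)).le
    exact_mod_cast h'
  exact h (n + 1) φ (hφ.of_tsupport_subset (hn.trans hsub))

/-- `IsConservative` is insensitive to a modification of `u` on a Lebesgue-null set of space–time
(`integral_integral_congr_ae_prod`). [folklore] -/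
theorem isConservative_congr_ae {u u' : ℝ → (EuclideanSpace ℝ (Fin 3)) → (EuclideanSpace ℝ (Fin 3))} {p : ℝ → (EuclideanSpace ℝ (Fin 3)) → ℝ}
    (h : (∀ φ : ℝ → EuclideanSpace ℝ (Fin 3) → ℝ, IsSpaceTimeTestOn (slab (EuclideanSpace ℝ (Fin 3)) (Set.Iio 0) isOpen_Iio) φ →
      ∫ t, ∫ x, (‖u t x‖ ^ 2 * timeDeriv φ t x + (‖u t x‖ ^ 2 + 2 * p t x) * ⟪u t x, gradient (φ t) x⟫) = 0))
    (hae : ∀ᵐ z : ℝ × (EuclideanSpace ℝ (Fin 3)) ∂volume, uncurry u z = uncurry u' z) :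
    (∀ φ : ℝ → EuclideanSpace ℝ (Fin 3) → ℝ, IsSpaceTimeTestOn (slab (EuclideanSpace ℝ (Fin 3)) (Set.Iio 0) isOpen_Iio) φ →
      ∫ t, ∫ x, (‖u' t x‖ ^ 2 * timeDeriv φ t x + (‖u' t x‖ ^ 2 + 2 * p t x) * ⟪u' t x, gradient (φ t) x⟫) = 0) := by
  intro φ hφ
  rw [← h φ hφ]
  refine integral_integral_congr_ae_prod ?_
  filter_upwards [hae] with z hz
  change u z.1 z.2 = u' z.1 z.2 at hz
  rw [hz]



end Summit.NavierStokesRegularity.NavierStokesRegularity.Theorems.ConservativeEngine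

end
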